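import Summits.Parity.GeneralizedHardyLittlewood.Theses.PrimeLevelFamEdge
import Literature.NumberTheory.LFunctions.KMVMomentAsymptoticsUniqueness
import Literature.NumberTheory.LFunctions.KloostermanPrimePower
import Literature.NumberTheory.Sieve.MontgomeryVaughan1975MajorArcs
import HarnessLib

/-!
# Sketch — crux-ideate r1 ideator 1 on `PrimeLevelFamEdge.MomentsBeyondDiagonal` (stmt-Parity-20007)

First-lemma signatures for the two crux idea cards
`exceptional-free-level-dichotomy` (card 1) and `bprz-gl1-twin-transfer` (card 2).
Sorries ONLY inside `firstLemma_*` theorems; everything else is a definition or a proved glue.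
No Landau–Siegel statement is proved here.
-/

noncomputable section

open scoped Real BigOperators
open Finset Polynomial

namespace Summit.Parity.GeneralizedHardyLittlewood.Cruxes.MomentsBeyondDiagonal.IdeasR1I1

open Literature.NumberTheory.LFunctions
open Literature.NumberTheory.LFunctions.KMV2000
open Literature.NumberTheory.Sieve.MontgomeryVaughan1975 (IsExceptionalZero Lemma41At)

/-! ## Card 1 — exceptional-free levels: the window logic, the coarse/exc-free retypes, the glue -/

/-- The Kloosterman `c`-layer of the beyond-diagonal off-diagonal at prime level `q` with mollifier
excess `η = Δ - 1` only sees Dirichlet characters of modulus `≤ R(q) = q̂^η (log q̂)^B`. The level is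
**exceptional-free** (constant `c₁`) when no `(c₁, R(q))`-exceptional real zero exists
(Montgomery–Vaughan's Lemma 4.1 currency, `IsExceptionalZero`). -/
def ExcFreeLevel (c₁ B η : ℝ) (q : ℕ) : Prop :=
  ∀ (r : ℕ) [NeZero r] (χ : DirichletCharacter ℂ r) (β : ℝ),
    ¬ IsExceptionalZero c₁ ((qhat q) ^ η * (Real.log (qhat q)) ^ B) r χ β

/-- `MomentAsymptotics` (KMV shape, typed precision) asserted ONLY at exceptional-free levels. -/
def MomentAsymptoticsExcFree (Δlo Δhi : ℝ) (T₁ T₂ : ℝ → ℝ[X] → ℝ[X] → ℝ) : Prop :=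
  ∀ P Q : ℝ[X], KMV2000.Admissible P → IsEvenOrOdd Q → ∀ Δ : ℝ, Δlo < Δ → Δ ≤ Δhi →
    ∃ c₁ : ℝ, 0 < c₁ ∧ ∃ B : ℝ, ∃ C : ℝ, ∃ q₀ : ℕ, ∀ (q : ℕ) [NeZero q], q.Prime → q₀ ≤ q →
      (∀ n : ℕ, (n : ℝ) ≠ qhat q ^ Δ) → ExcFreeLevel c₁ B (Δ - 1) q →
        ‖LhPQ q P Q (qhat q ^ Δ) -
            ((riemannZeta 2 * ((Real.sqrt (qhat q) / (Δ * Real.log (qhat q)) : ℝ) : ℂ)) *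
              ((KMV2000.linForm Δ P Q + T₁ Δ P Q : ℝ) : ℂ))‖ ≤
          C * Real.sqrt (qhat q) * (Real.log (qhat q))⁻¹ ^ 2 ∧
        ‖QhPQ q P Q (qhat q ^ Δ) -
            ((2 * riemannZeta 2 ^ 2 * ((qhat q / (Δ ^ 2 * Real.log (qhat q) ^ 2) : ℝ) : ℂ)) *
              ((KMV2000.secondMomentForm Δ P Q + T₂ Δ P Q : ℝ) : ℂ))‖ ≤
          C * qhat q * (Real.log (qhat q))⁻¹ ^ 3

/-- The EXPLICIT-DECAY shape the re-glued `closes` would consume: at `(c₁)`-exceptional-free levels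
the RELATIVE error is `≤ C · exp(-κ/(Δ-1))` with `C` UNIFORM in `Δ ∈ (1, Δhi]` (so that the consumer
may take `Δ - 1` small AFTER seeing `C, κ`: the `> 50 %` margin is `Θ(Δ-1) ≫ C e^{-κ/(Δ-1)}`). This is
the precision Gallagher's log-free density delivers (`κ ≍ c₁`). `c₁` is a parameter: the consumer
fixes it below Landau's pair-repulsion constant. -/
def MomentAsymptoticsExcFreeExp (c₁ Δhi κ : ℝ) (T₁ T₂ : ℝ → ℝ[X] → ℝ[X] → ℝ) : Prop :=
  ∀ P Q : ℝ[X], KMV2000.Admissible P → IsEvenOrOdd Q → ∃ C : ℝ, ∀ Δ : ℝ, 1 < Δ → Δ ≤ Δhi →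
    ∃ B : ℝ, ∃ q₀ : ℕ, ∀ (q : ℕ) [NeZero q], q.Prime → q₀ ≤ q →
      (∀ n : ℕ, (n : ℝ) ≠ qhat q ^ Δ) → ExcFreeLevel c₁ B (Δ - 1) q →
        ‖LhPQ q P Q (qhat q ^ Δ) -
            ((riemannZeta 2 * ((Real.sqrt (qhat q) / (Δ * Real.log (qhat q)) : ℝ) : ℂ)) *
              ((KMV2000.linForm Δ P Q + T₁ Δ P Q : ℝ) : ℂ))‖ ≤
          C * Real.exp (-(κ / (Δ - 1))) * Real.sqrt (qhat q) * (Real.log (qhat q))⁻¹ ∧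
        ‖QhPQ q P Q (qhat q ^ Δ) -
            ((2 * riemannZeta 2 ^ 2 * ((qhat q / (Δ ^ 2 * Real.log (qhat q) ^ 2) : ℝ) : ℂ)) *
              ((KMV2000.secondMomentForm Δ P Q + T₂ Δ P Q : ℝ) : ℂ))‖ ≤
          C * Real.exp (-(κ / (Δ - 1))) * qhat q * (Real.log (qhat q))⁻¹ ^ 2

/-- K_A at exceptional-free levels, typed precision (the phantom-free part of K_A). -/
def MomentsBeyondDiagonalExcFree : Prop :=
  ∃ Δ : ℝ, 1 < Δ ∧ ∃ T₁ T₂ : ℝ → ℝ[X] → ℝ[X] → ℝ, MomentAsymptoticsExcFree 1 Δ T₁ T₂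

/-- The UNCONDITIONAL TARGET of card 1 (what the re-glued `closes` consumes instead of K_A): level-free
functionals `T₁, T₂` once and for all; for every exceptional-strip constant `c₁ > 0` an explicit decay
rate `κ` and a window `(1, Δhi]` on which the exceptional-free asymptotics hold with relative error
`C(P,Q) · exp(-κ/(Δ-1))`. -/
def MomentsBeyondDiagonalExcFreeExp : Prop :=
  ∃ T₁ T₂ : ℝ → ℝ[X] → ℝ[X] → ℝ, ∀ c₁ : ℝ, 0 < c₁ → ∃ κ : ℝ, 0 < κ ∧ ∃ Δhi : ℝ, 1 < Δhi ∧
    MomentAsymptoticsExcFreeExp c₁ Δhi κ T₁ T₂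

/-- The declared BRIDGE CONDITION (NoSiegelZeros-class, named, never proved here): every large
prime level is exceptional-free for the excess window `(1, Δhi]`. -/
def AllLargeLevelsExcFree (Δhi : ℝ) : Prop :=
  ∀ Δ : ℝ, 1 < Δ → Δ ≤ Δhi → ∀ c₁ : ℝ, 0 < c₁ → ∀ B : ℝ, ∃ q₁ : ℕ, ∀ q : ℕ, q.Prime → q₁ ≤ q →
    ExcFreeLevel c₁ B (Δ - 1) q

/-- GLUE (proved): K_A as typed implies its exceptional-free restriction (drop the hypothesis). -/
theorem excFree_of_momentsBeyondDiagonal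
    (hA : Summit.Parity.GeneralizedHardyLittlewood.Theses.PrimeLevelFamEdge.MomentsBeyondDiagonal) :
    MomentsBeyondDiagonalExcFree := by
  obtain ⟨Δ, hΔ, T₁, T₂, hMA⟩ := hA
  refine ⟨Δ, hΔ, T₁, T₂, ?_⟩
  intro P Q hP hQ Δ' hlo hhi
  obtain ⟨C, q₀, H⟩ := hMA P Q hP hQ Δ' hlo hhi
  refine ⟨1, one_pos, 0, C, q₀, ?_⟩
  intro q _ hq hq₀ hM _hW
  exact H q hq hq₀ hM

/-- GLUE (proved): the conditional bridge — exceptional-free K_A plus the NoSiegel-class condition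
`AllLargeLevelsExcFree` gives K_A as typed. (For the ROUTE this bridge is circular; card 1's point is
that `closes` consumes K_A only at D-relative levels `q ≤ D^K`, where a Page dichotomy replaces it.) -/
theorem momentsBeyondDiagonal_of_excFree_of_allLevels
    (h : MomentsBeyondDiagonalExcFree) (hW : ∀ Δhi : ℝ, AllLargeLevelsExcFree Δhi) :
    Summit.Parity.GeneralizedHardyLittlewood.Theses.PrimeLevelFamEdge.MomentsBeyondDiagonal := by
  obtain ⟨Δ, hΔ, T₁, T₂, hMA⟩ := h
  refine ⟨Δ, hΔ, T₁, T₂, ?_⟩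
  intro P Q hP hQ Δ' hlo hhi
  obtain ⟨c₁, hc₁, B, C, q₀, H⟩ := hMA P Q hP hQ Δ' hlo hhi
  obtain ⟨q₁, hq₁⟩ := hW Δ Δ' hlo hhi c₁ hc₁ B
  refine ⟨C, max q₀ q₁, ?_⟩
  intro q _ hq hq₀ hM
  exact H q hq (le_trans (le_max_left _ _) hq₀) hM (hq₁ q hq (le_trans (le_max_right _ _) hq₀))

/-- PAGE BRANCH (proved): if some OTHER modulus `D' ≠ D` carries a `(c₁, P)`-exceptional zero and
Lemma 4.1 (Page) holds at level `P ≥ D`, then `L(σ, χ_D) ≠ 0` on `[1 - c₁/log P, 1)` — the branch of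
the dichotomy in which Theorem 1 for `χ_D` follows from a zero-free interval, K_A never invoked. -/
theorem lfunction_ne_zero_of_other_exceptional {c₁ P : ℝ} (hPage : Lemma41At c₁ P)
    {D' : ℕ} [NeZero D'] {χ' : DirichletCharacter ℂ D'} {β' : ℝ}
    (hexc : IsExceptionalZero c₁ P D' χ' β') {D : ℕ} [NeZero D] (χ : DirichletCharacter ℂ D)
    (hχ : χ.IsPrimitive) (hχ1 : χ ≠ 1) (hD : (D : ℝ) ≤ P) (hne : D ≠ D') {σ : ℝ}
    (hσ : 1 - c₁ / Real.log P ≤ σ) (hσ1 : σ < 1) : χ.LFunction σ ≠ 0 := by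
  intro h0
  have hexcD : IsExceptionalZero c₁ P D χ σ := ⟨hχ, hχ1, hD, hσ, hσ1, h0⟩
  exact hne (hPage.2 D D' χ χ' σ β' hexcD hexc).1

/-- FIRST LEMMA of card 1 (analytic heart of the pricing step; Stieltjes form of Gallagher's
log-free density ⇒ cost): zeros `β ∈ S` with a zero-free gap `δ₀`, density
`#{β ≥ 1-δ} ≤ C₀ e^{c₂ L δ}`; then `∑ x^{β-1} ≤ 2 C₀ e^{-(X - c₂L) δ₀} · X/(X - c₂L)`, `X = log x`. -/
theorem firstLemma_zeroSum_of_logFreeDensity (S : Finset ℝ) (X L C₀ c₂ δ₀ : ℝ)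
    (hC : 0 ≤ C₀) (hδ₀ : 0 < δ₀) (hL : 0 ≤ c₂ * L) (hX : c₂ * L < X)
    (hzfr : ∀ β ∈ S, β ≤ 1 - δ₀) (hS : ∀ β ∈ S, 0 ≤ β)
    (hdens : ∀ δ : ℝ, δ₀ ≤ δ → δ ≤ 1 →
      (((S.filter (fun β ↦ 1 - δ ≤ β)).card : ℕ) : ℝ) ≤ C₀ * Real.exp (c₂ * L * δ)) :
    ∑ β ∈ S, Real.exp ((β - 1) * X) ≤
      2 * C₀ * Real.exp (-((X - c₂ * L) * δ₀)) * (X / (X - c₂ * L)) := by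
  sorry

/-! ## Card 2 — the GL(1) twin (BPRZ 2020) transfer: Kloosterman layer separation + located residual -/

/-- FIRST LEMMA of card 2 (twisted multiplicativity = separation of the `c`-layer from the level
layer): `S(m,n;cq) = S(q̄m, q̄n; c) · S(c̄m, c̄n; q)` for `(c,q) = 1`. [folklore; Iwaniec–Kowalski (1.59)] -/
theorem firstLemma_kloosterman_layers (c q : ℕ) [NeZero c] [NeZero q] [NeZero (c * q)]
    (hcq : Nat.Coprime c q) (m n : ℤ) :
    kloostermanSum (c * q) (m : ZMod (c * q)) (n : ZMod (c * q)) =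
      kloostermanSum c ((m : ZMod c) * ((q : ZMod c))⁻¹) ((n : ZMod c) * ((q : ZMod c))⁻¹) *
        kloostermanSum q ((m : ZMod q) * ((c : ZMod q))⁻¹) ((n : ZMod q) * ((c : ZMod q))⁻¹) := by
  sorry

/-- Corollary shape (root-number / Atkin–Lehner channel = cusp pair `∞, 0`): for `q` prime, `(b,q)=1`,
`q ∤ n`, `S(qm, n; bq) = - S(m, q̄ n; b)` (the level layer collapses to the Ramanujan sum `-1`). -/
theorem firstLemma_cusp_collapse (b q : ℕ) [NeZero b] [NeZero q] [NeZero (b * q)] (hq : q.Prime)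
    (hbq : Nat.Coprime b q) (m n : ℤ) (hn : ¬ (q : ℤ) ∣ n) :
    kloostermanSum (b * q) (((q : ℤ) * m : ℤ) : ZMod (b * q)) (n : ZMod (b * q)) =
      - kloostermanSum b (m : ZMod b) ((n : ZMod b) * ((q : ZMod b))⁻¹) := by
  sorry

/-- THE LOCATED RESIDUAL of card 2 (where the exceptional modulus `D` enters, and nowhere else):
mollifier character sums to moduli `r ≤ M^θ` (`θ ↔ (Δ-1)/Δ + ε`: the Kloosterman `c`-layer range
`Z q^ε = q̂^{Δ-1+ε}` against `M = q̂^Δ`) are `ε`-small against the principal mollifier mass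
`√M / log M`. For ALL characters (real included) this is NoSiegelZeros-class; card 1 replaces the
`∀ χ` by "exceptional-free level + log-free density". -/
def MollifierCharSumBound (θ : ℝ) : Prop :=
  ∀ ε : ℝ, 0 < ε → ∃ M₀ : ℝ, ∀ M : ℝ, M₀ ≤ M → ∀ (r : ℕ) [NeZero r] (χ : DirichletCharacter ℂ r),
    χ ≠ 1 → (r : ℝ) ≤ M ^ θ →
      ‖∑ m ∈ Finset.Icc 1 ⌊M⌋₊, ((ArithmeticFunction.moebius m : ℤ) : ℂ) * χ (m : ZMod r) *
          ((m : ℂ) ^ (-(1 / 2 : ℂ))) * ((Real.log (M / m) / Real.log M : ℝ) : ℂ)‖ ≤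
        ε * Real.sqrt M / Real.log M

end Summit.Parity.GeneralizedHardyLittlewood.Cruxes.MomentsBeyondDiagonal.IdeasR1I1
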